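import Literature.AlgebraicGeometry.Resolution.BlowupChartModule
import Mathlib.RingTheory.Localization.LocalizationLocalization
import HarnessLib

/-!
# The charts `R[I/g]` of a blowing up of a domain inside the fraction field

Topic: `Literature/AlgebraicGeometry/Resolution`. For a domain `R` with fraction field `K`, an
ideal `I` and `0 ≠ g`, the affine blow-up algebra `R[I/g] ⊆ R[1/g]` (`blowupAlgebra I g`, image
model of Stacks 052Q/07Z3) is isomorphic to the subalgebra `R[y/g : y ∈ I] ⊆ K` (`fracChart I g`,
`blowupAlgebraEquivFracChart`). Inside `K` all charts can be compared: if `G, G' ∈ I` are nonzero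
and `G/G' ∈ R[I/G]` (i.e. `G'/G` is a unit of `R[I/G]`), then `R[I/G'] ⊆ R[I/G]` and
`R[I/G] = R[I/G'][(G/G')⁻¹]` is a localization (`fracChart_le_of_div_mem`,
`isLocalization_away_fracChart`) — the statement "`D₊(Gt) ⊆ D₊(G't)` in `Proj R[It]`"
(Stacks 0804/01PX) in affine terms — and the local rings of `R[I/G]` at primes are local rings of
`R[I/G']` (`isLocalization_atPrime_fracChart_of_le`).

Everything is proved; no named facts.

## References

* [StacksProject] The Stacks Project, Tags 052Q, 0804, 01PX.
* [GortzWedhorn2020] U. Görtz, T. Wedhorn, *Algebraic Geometry I*, 2nd ed., (13.19) p. 415.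
-/

noncomputable section

open IsLocalization

namespace Literature.AlgebraicGeometry.Resolution

universe u

variable {R : Type u} [CommRing R] [IsDomain R] (I : Ideal R)

/-! ## `R[1/g] → K` -/

/-- Powers of a nonzero `g` become units in the fraction field. [folklore] -/
theorem isUnit_algebraMap_fractionRing_powers {g : R} (hg : g ≠ 0)
    (y : Submonoid.powers g) : IsUnit (algebraMap R (FractionRing R) y) := by
  obtain ⟨_, n, rfl⟩ := y
  exact isUnit_iff_ne_zero.mpr
    ((map_ne_zero_iff _ (IsFractionRing.injective R (FractionRing R))).mpr (pow_ne_zero n hg))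

/-- **`R[1/g] → Frac R`** for `g ≠ 0` in a domain. [folklore] -/
def awayToFrac {g : R} (hg : g ≠ 0) : Localization.Away g →ₐ[R] FractionRing R where
  toRingHom := IsLocalization.lift (M := Submonoid.powers g)
    (g := algebraMap R (FractionRing R)) (isUnit_algebraMap_fractionRing_powers hg)
  commutes' r := IsLocalization.lift_eq _ r

/-- `r ↦ r`. [folklore] -/
theorem awayToFrac_algebraMap {g : R} (hg : g ≠ 0) (r : R) :
    awayToFrac hg (algebraMap R (Localization.Away g) r) = algebraMap R (FractionRing R) r :=
  IsLocalization.lift_eq _ r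

/-- `1/g ↦ g⁻¹`. [folklore] -/
theorem awayToFrac_invSelf {g : R} (hg : g ≠ 0) :
    awayToFrac hg (Away.invSelf g) = (algebraMap R (FractionRing R) g)⁻¹ := by
  have hg' : algebraMap R (FractionRing R) g ≠ 0 :=
    (map_ne_zero_iff _ (IsFractionRing.injective R (FractionRing R))).mpr hg
  have h : awayToFrac hg (Away.invSelf g) * algebraMap R (FractionRing R) g = 1 := by
    rw [← awayToFrac_algebraMap hg g, ← map_mul, mul_comm, Away.mul_invSelf, map_one]
  exact (eq_inv_of_mul_eq_one_left h)

/-- `y/gⁿ ↦ y/gⁿ`. [folklore] -/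
theorem awayToFrac_algebraMap_mul_invSelf_pow {g : R} (hg : g ≠ 0) (y : R) (n : ℕ) :
    awayToFrac hg (algebraMap R (Localization.Away g) y * Away.invSelf g ^ n) =
      algebraMap R (FractionRing R) y / algebraMap R (FractionRing R) g ^ n := by
  rw [map_mul, map_pow, awayToFrac_algebraMap, awayToFrac_invSelf, inv_pow, div_eq_mul_inv]

/-- `R[1/g] → Frac R` is injective. [folklore] -/
theorem awayToFrac_injective {g : R} (hg : g ≠ 0) : Function.Injective (awayToFrac hg) := by
  rw [injective_iff_map_eq_zero]
  intro z hz
  obtain ⟨⟨r, s⟩, rfl⟩ := IsLocalization.mk'_surjective (Submonoid.powers g) z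
  dsimp only at hz ⊢
  have hspec := IsLocalization.mk'_spec (Localization.Away g) r s
  have h0 : algebraMap R (FractionRing R) r = 0 := by
    have := congrArg (awayToFrac hg) hspec
    rwa [map_mul, hz, zero_mul, awayToFrac_algebraMap, eq_comm] at this
  rw [(map_eq_zero_iff _ (IsFractionRing.injective R (FractionRing R))).mp h0,
    IsLocalization.mk'_zero]

/-! ## The chart inside `K` -/

/-- **`R[I/g] ⊆ Frac R`**: the `R`-subalgebra generated by the `y/g`, `y ∈ I`.
[cite: StacksProject, Tag 052Q] [cite: GortzWedhorn2020, (13.19) p. 415] -/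
def fracChart (g : R) : Subalgebra R (FractionRing R) :=
  Algebra.adjoin R ((fun y => algebraMap R (FractionRing R) y / algebraMap R (FractionRing R) g) '' I)

variable {I} in
/-- `y/g ∈ R[I/g]` for `y ∈ I`. [folklore] -/
theorem div_mem_fracChart (g : R) {y : R} (hy : y ∈ I) :
    algebraMap R (FractionRing R) y / algebraMap R (FractionRing R) g ∈ fracChart I g :=
  Algebra.subset_adjoin ⟨y, hy, rfl⟩

/-- The image of `blowupAlgebra I g ⊆ R[1/g]` in `K` is `fracChart I g`. [folklore] -/
theorem map_blowupAlgebra_awayToFrac {g : R} (hg : g ≠ 0) :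
    (blowupAlgebra I g).map (awayToFrac hg) = fracChart I g := by
  rw [blowupAlgebra, AlgHom.map_adjoin, fracChart]
  congr 1
  ext z
  constructor
  · rintro ⟨_, ⟨y, hy, rfl⟩, rfl⟩
    exact ⟨y, hy, by rw [← pow_one (Away.invSelf g), awayToFrac_algebraMap_mul_invSelf_pow, pow_one]⟩
  · rintro ⟨y, hy, rfl⟩
    exact ⟨_, ⟨y, hy, rfl⟩, by
      rw [← pow_one (Away.invSelf g), awayToFrac_algebraMap_mul_invSelf_pow, pow_one]⟩

/-- **`blowupAlgebra I g ≃ₐ[R] fracChart I g`** for `g ≠ 0` in a domain. [folklore] -/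
def blowupAlgebraEquivFracChart {g : R} (hg : g ≠ 0) : blowupAlgebra I g ≃ₐ[R] fracChart I g :=
  (Subalgebra.equivMapOfInjective _ _ (awayToFrac_injective hg)).trans
    (Subalgebra.equivOfEq _ _ (map_blowupAlgebra_awayToFrac I hg))

/-- The isomorphism is `awayToFrac` on elements. [folklore] -/
@[simp]
theorem coe_blowupAlgebraEquivFracChart {g : R} (hg : g ≠ 0) (z : blowupAlgebra I g) :
    (blowupAlgebraEquivFracChart I hg z : FractionRing R) = awayToFrac hg z := rfl

variable {I} in
/-- `y/gⁿ ∈ R[I/g]` for `y ∈ Iⁿ`. [folklore] -/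
theorem div_pow_mem_fracChart {g : R} (hg : g ≠ 0) {n : ℕ} {y : R} (hy : y ∈ I ^ n) :
    algebraMap R (FractionRing R) y / algebraMap R (FractionRing R) g ^ n ∈ fracChart I g := by
  have := (blowupAlgebraEquivFracChart I hg (blowupAlgebra.divPow I g hy)).2
  rwa [coe_blowupAlgebraEquivFracChart, blowupAlgebra.coe_divPow,
    awayToFrac_algebraMap_mul_invSelf_pow] at this

variable {I} in
/-- Elements of `R[I/g]` (`g ∈ I`) are fractions `y/gⁿ` with `y ∈ Iⁿ`. [folklore] -/
theorem exists_of_mem_fracChart {g : R} (hg : g ≠ 0) (hgI : g ∈ I) {z : FractionRing R}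
    (hz : z ∈ fracChart I g) :
    ∃ (n : ℕ) (y : R), y ∈ I ^ n ∧
      z = algebraMap R (FractionRing R) y / algebraMap R (FractionRing R) g ^ n := by
  obtain ⟨w, hw⟩ := (blowupAlgebraEquivFracChart I hg).surjective ⟨z, hz⟩
  obtain ⟨n, y, hy, hwy⟩ := blowupAlgebra.exists_eq_mul_invSelf_pow I g hgI w.2
  refine ⟨n, y, hy, ?_⟩
  have := congrArg (fun v : fracChart I g => (v : FractionRing R)) hw
  simp only [coe_blowupAlgebraEquivFracChart] at this
  rw [← this, hwy, awayToFrac_algebraMap_mul_invSelf_pow]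

/-- `R[I/g]` is a domain. [folklore] -/
instance (g : R) : IsDomain (fracChart I g) := inferInstance

/-! ## Comparing two charts: `R[I/G'] ⊆ R[I/G] = R[I/G'][(G/G')⁻¹]` -/

section Compare

variable {I} {G G' : R} (hG : G ∈ I) (hG' : G' ∈ I) (hG0 : G ≠ 0) (hG'0 : G' ≠ 0)

/-- **`R[I/G'] ⊆ R[I/G]` as soon as `G/G' ∈ R[I/G]`** (i.e. `G'/G` is a unit of `R[I/G]`):
`y/G' = (G/G') (y/G)`. [cite: StacksProject, Tag 0804] -/
theorem fracChart_le_of_div_mem (hG0 : G ≠ 0)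
    (h : algebraMap R (FractionRing R) G / algebraMap R (FractionRing R) G' ∈ fracChart I G) :
    fracChart I G' ≤ fracChart I G := by
  refine Algebra.adjoin_le ?_
  rintro _ ⟨y, hy, rfl⟩
  show algebraMap R (FractionRing R) y / algebraMap R (FractionRing R) G' ∈ fracChart I G
  have hGK : algebraMap R (FractionRing R) G ≠ 0 :=
    (map_ne_zero_iff _ (IsFractionRing.injective R (FractionRing R))).mpr hG0
  have : algebraMap R (FractionRing R) y / algebraMap R (FractionRing R) G' =
      algebraMap R (FractionRing R) G / algebraMap R (FractionRing R) G' *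
        (algebraMap R (FractionRing R) y / algebraMap R (FractionRing R) G) := by
    field_simp
  rw [this]
  exact mul_mem h (div_mem_fracChart G hy)

/-- The element `U = G/G'` of `R[I/G']` (`G ∈ I`). [folklore] -/
def divElem (hG : G ∈ I) (G' : R) : fracChart I G' :=
  ⟨algebraMap R (FractionRing R) G / algebraMap R (FractionRing R) G', div_mem_fracChart G' hG⟩

/-- `divElem` is `G/G'`. [folklore] -/
@[simp]
theorem coe_divElem (hG : G ∈ I) (G' : R) :
    (divElem hG G' : FractionRing R) =
      algebraMap R (FractionRing R) G / algebraMap R (FractionRing R) G' := rfl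

/-- **`R[I/G] = R[I/G'][(G/G')⁻¹]`** when `R[I/G'] ⊆ R[I/G]` (`G, G' ∈ I` nonzero; the
inclusion is any algebra structure compatible with the embeddings in `K`, e.g.
`(Subalgebra.inclusion (fracChart_le_of_div_mem …)).toAlgebra`): the chart `D₊(Gt)` is the basic
open `D(G/G')` of `D₊(G't)`. [cite: StacksProject, Tag 0804] -/
theorem isLocalization_away_fracChart [Algebra (fracChart I G') (fracChart I G)]
    (halg : ∀ z : fracChart I G',
      (algebraMap (fracChart I G') (fracChart I G) z : FractionRing R) = z)
    (hG : G ∈ I) (hG' : G' ∈ I) (hG0 : G ≠ 0) (hG'0 : G' ≠ 0) :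
    IsLocalization.Away (divElem hG G') (fracChart I G) := by
  have hGK : algebraMap R (FractionRing R) G ≠ 0 :=
    (map_ne_zero_iff _ (IsFractionRing.injective R (FractionRing R))).mpr hG0
  have hG'K : algebraMap R (FractionRing R) G' ≠ 0 :=
    (map_ne_zero_iff _ (IsFractionRing.injective R (FractionRing R))).mpr hG'0
  -- `G/G'` is a unit of `R[I/G]`, with inverse `G'/G`
  have hunit : IsUnit (algebraMap (fracChart I G') (fracChart I G) (divElem hG G')) := by
    refine IsUnit.of_mul_eq_one ⟨_, div_mem_fracChart G hG'⟩ (Subtype.ext ?_)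
    rw [Subalgebra.coe_mul, halg, coe_divElem, Subalgebra.coe_one, div_mul_div_cancel₀' hGK,
      div_self hG'K]
  refine { map_units := ?_, surj := ?_, exists_of_eq := ?_ }
  · rintro ⟨_, n, rfl⟩
    rw [map_pow]
    exact hunit.pow n
  · intro z
    obtain ⟨n, y, hy, hz⟩ := exists_of_mem_fracChart hG0 hG z.2
    refine ⟨(⟨_, div_pow_mem_fracChart hG'0 hy⟩, ⟨divElem hG G' ^ n, n, rfl⟩), Subtype.ext ?_⟩
    show (z : FractionRing R) * (algebraMap (fracChart I G') (fracChart I G) (divElem hG G' ^ n) :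
        FractionRing R) = algebraMap (fracChart I G') (fracChart I G) ⟨_, div_pow_mem_fracChart hG'0 hy⟩
    rw [halg, halg, Subalgebra.coe_pow, coe_divElem, hz, div_pow,
      div_mul_div_cancel₀ (pow_ne_zero n hGK)]
  · intro a b hab
    refine ⟨1, ?_⟩
    have : (a : FractionRing R) = b := by rw [← halg a, ← halg b, hab]
    rw [Subtype.ext this]

/-- **Local rings of `R[I/G]` are local rings of `R[I/G']`** (when `R[I/G'] ⊆ R[I/G]`, i.e.
`D₊(Gt) ⊆ D₊(G't)`): a localization of `R[I/G]` at a prime `𝔴` is the localization of `R[I/G']`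
at `𝔴 ∩ R[I/G']`. [cite: StacksProject, Tag 0804] -/
theorem isLocalization_atPrime_fracChart [Algebra (fracChart I G') (fracChart I G)]
    (halg : ∀ z : fracChart I G',
      (algebraMap (fracChart I G') (fracChart I G) z : FractionRing R) = z)
    (hG : G ∈ I) (hG' : G' ∈ I) (hG0 : G ≠ 0) (hG'0 : G' ≠ 0)
    (𝔴 : Ideal (fracChart I G)) [𝔴.IsPrime] (S : Type*) [CommRing S] [Algebra (fracChart I G) S]
    [Algebra (fracChart I G') S] [IsScalarTower (fracChart I G') (fracChart I G) S]
    [IsLocalization.AtPrime S 𝔴] :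
    IsLocalization.AtPrime S (𝔴.comap (algebraMap (fracChart I G') (fracChart I G))) := by
  haveI := isLocalization_away_fracChart halg hG hG' hG0 hG'0
  exact IsLocalization.isLocalization_isLocalization_atPrime_isLocalization
    (Submonoid.powers (divElem hG G')) (T := S) 𝔴

omit [IsDomain R] in
/-- The inclusion algebra `R[I/G'] → R[I/G]` of `fracChart_le_of_div_mem`. [folklore] -/
theorem algebraMap_inclusion_coe {S T : Subalgebra R (FractionRing R)} (hST : S ≤ T) (z : S) :
    letI := (Subalgebra.inclusion hST).toAlgebra
    (algebraMap S T z : FractionRing R) = z := rfl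

omit [IsDomain R] in
/-- Contractions are compatible: `(𝔴 ∩ S) ∩ R = 𝔴 ∩ R` for subalgebras `S ≤ T`. [folklore] -/
theorem comap_comap_inclusion {A : Type*} [CommRing A] [Algebra R A] {S T : Subalgebra R A}
    (hST : S ≤ T) (𝔴 : Ideal T) :
    (𝔴.comap (Subalgebra.inclusion hST)).comap (algebraMap R S) = 𝔴.comap (algebraMap R T) := by
  ext r
  simp only [Ideal.mem_comap]
  exact Iff.of_eq (congrArg (· ∈ 𝔴) (Subtype.ext (by
    rw [Subalgebra.coe_algebraMap]; rfl)))

end Compare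

end Literature.AlgebraicGeometry.Resolution

end
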